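import Summits.Schanuel.Schanuel.Theses.BenfordTowers
import Literature.Barriers.Schanuel.AlgebraicIndependenceOfLogarithms
import Literature.Computability.AlgebraicComplexity.DeterminantalComplexityProofs
import Literature.AlgebraicGeometry.DeterminantalHypersurfaces.LinearPencilForms

/-!
# Birth skeleton — piece `BenfordTowers.HomPrimeLogSector` (stmt-Schanuel-11402), line `birth` (Roy pencil face)

Piece 1 (the OPEN half `T`) of the dictionary split `BenfordFamily ⇐ HomPrimeLogSector ∧ BenfordOfHom`
(crux strategist of stmt-Schanuel-11400, BC2 redirect, 2026-08-17).

Two stubs, neither the crux reworded, and a composition with real content: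

* `stub_homogeneousPencilRepr` (PROVABLE, M) — HOMOGENISED VALIANT UNIVERSALITY: every non-zero
  homogeneous `P ∈ ℚ[X₀,…,X_t]` of degree `d` is, up to the monomial factor `X₀^{m-d}`, the
  determinant of a LINEAR PENCIL of rational matrices `∑ₖ Xₖ Aₖ` (no constant term).  From the
  tree theorem `Literature.Computability.AlgebraicComplexity.exists_hasDetRepr_holds` (Valiant 1979:
  `P = det(M₀ + M₁(X))` with affine entries) by `t`-homogenisation `det(t M₀ + M₁(X)) = t^{m-d} P(X)`
  (joint homogeneity + comparison of `X`-degrees) and the substitution `t := X₀`.  This is the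
  device of Roy 1995 §3.1 (affine homogeneous varieties are reached by determinantal ones).
* `stub_primeLogPencilNonsingular` (OPEN; TRANSFER) — ROY'S RANK CONJECTURE, SQUARE PENCIL FORM,
  FOR LOGARITHMS OF PRIMES: a linear pencil of rational matrices whose determinant is a non-zero
  polynomial stays non-singular at `X = (log ℓₖ)` for distinct primes `ℓₖ`.  Equivalently: every
  square matrix with entries in `V = span_ℚ{log p}` has rank = Roy's structural rank
  (`Literature.Barriers.Schanuel.structuralRank`; the structural rank is the generic rank of the
  rational pencil, tree theorem `structuralRank_eq_iSup_rank_of_eq_sum_smul`).  WHY EASIER / what it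
  exposes: the only unconditional several-variables technology (Waldschmidt's linear subgroup
  theorem) speaks this language — `structuralRank M ≤ 2 · rank M` for matrices over `𝓛 ⊇ V`
  (`Literature.Barriers.Schanuel.roy1995_structuralRank_le_two_mul_rank`, Roy 1995 Cor. 1.3), with
  equality `r = s` reached in rectangular regimes `dl > r(d+l)` (six exponentials, strong six
  exponentials `roy1992_strongSixExponentials`); the open content is the factor `2` in the square
  regime, graded by format, smallest open cell = `2 × 2` rank one = four exponentials
  (= the route's `Level2Core` matrices).  By `HomPrimeLogSector → (this stub)` (easy: the pencil
  determinant is homogeneous of degree `m`) the stub is EQUIVALENT to the piece — a transfer, not a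
  weakening; declared as such in the line card.
* `HomPrimeLogSector_of` — composition: a homogeneous relation `P(log ℓ) = 0` gives, by the first
  stub, a rational pencil with `det = X₀^{m-d} P ≠ 0` whose value at `log ℓ` has determinant
  `(log ℓ₀)^{m-d} · P(log ℓ) = 0` (`RingHom.map_det`), contradicting the second stub; the case of
  `r = 0` variables is direct (`P` is a non-zero constant).
-/

noncomputable section

open scoped BigOperators
open MvPolynomial

namespace Summit.Schanuel.Schanuel.Cruxes.HomPrimeLogSector.Birth

open Summit.Schanuel.Schanuel.Theses.BenfordTowers

/-- stub (provable, M): homogenised Valiant universality — every non-zero homogeneous polynomial of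
degree `d` in `t+1` variables over `ℚ` is `X₀^{-(m-d)} · det(∑ₖ Xₖ Aₖ)` for some size `m ≥ d` and
rational matrices `A₀,…,A_t`. [Valiant1979 Thm 1 = tree `exists_hasDetRepr_holds`; Roy1995 §3.1] -/
theorem stub_homogeneousPencilRepr :
    ∀ (t d : ℕ) (P : MvPolynomial (Fin (t + 1)) ℚ), P.IsHomogeneous d → P ≠ 0 →
      ∃ (m : ℕ) (A : Fin (t + 1) → Matrix (Fin m) (Fin m) ℚ), d ≤ m ∧
        (∑ k, (X k : MvPolynomial (Fin (t + 1)) ℚ) •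
            (A k).map (fun q : ℚ => (C q : MvPolynomial (Fin (t + 1)) ℚ))).det
          = X 0 ^ (m - d) * P := by
  sorry

/-- stub (OPEN; transfer — Roy's rank conjecture, square-pencil form, for logarithms of primes): a
rational linear pencil with non-zero determinant polynomial is non-singular at `(log ℓₖ)ₖ` for
distinct primes `ℓₖ`. [Roy1995 Conj 1.1 + §1 Remark (i) (`r = s`), §3.1 Cor 3.2; Roy1992;
Waldschmidt2005 Conj 1.11; known half: `roy1995_structuralRank_le_two_mul_rank`] -/
theorem stub_primeLogPencilNonsingular :
    ∀ (t m : ℕ) (ℓ : Fin t → ℕ) (A : Fin t → Matrix (Fin m) (Fin m) ℚ),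
      (∀ k, (ℓ k).Prime) → Function.Injective ℓ →
      (∑ k, (X k : MvPolynomial (Fin t) ℚ) •
          (A k).map (fun q : ℚ => (C q : MvPolynomial (Fin t) ℚ))).det ≠ 0 →
      (∑ k, Real.log (ℓ k) • (A k).map (algebraMap ℚ ℝ)).det ≠ 0 := by
  sorry

/-- Entrywise: evaluating the pencil `∑ₖ Xₖ Aₖ` at `v` gives `∑ₖ vₖ Aₖ`. -/
theorem pencil_map_aeval (t m : ℕ) (A : Fin t → Matrix (Fin m) (Fin m) ℚ) (v : Fin t → ℝ) :
    (∑ k, (X k : MvPolynomial (Fin t) ℚ) •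
        (A k).map (fun q : ℚ => (C q : MvPolynomial (Fin t) ℚ))).map (aeval v)
      = ∑ k, v k • (A k).map (algebraMap ℚ ℝ) := by
  ext i j
  simp only [Matrix.map_apply, Matrix.sum_apply, Matrix.smul_apply, smul_eq_mul, map_sum,
    map_mul, aeval_X, aeval_C]

/-- COMPOSITION (real proof, the stubs used BY NAME): the two stubs imply the piece
`HomPrimeLogSector`. -/
theorem HomPrimeLogSector_of : HomPrimeLogSector := by
  have hRepr := stub_homogeneousPencilRepr
  have hPencil := stub_primeLogPencilNonsingular
  intro r ℓ hprime hinj d P hhom hP hzero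
  rcases Nat.eq_zero_or_pos r with hr | hr
  · -- no variables: `P` is a non-zero constant
    subst hr
    have hPC : P = C (coeff 0 P) := MvPolynomial.eq_C_of_isEmpty P
    have h0 : aeval (fun i => Real.log (ℓ i)) (C (coeff 0 P) : MvPolynomial (Fin 0) ℚ) = 0 := by
      rw [← hPC]; exact hzero
    rw [aeval_C, map_eq_zero_iff _ (algebraMap ℚ ℝ).injective] at h0
    apply hP
    rw [hPC, h0, C_0]
  · obtain ⟨t, rfl⟩ : ∃ t, r = t + 1 := ⟨r - 1, by omega⟩
    obtain ⟨m, A, hdm, hdet⟩ := hRepr t d P hhom hP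
    have hne : (∑ k, (X k : MvPolynomial (Fin (t + 1)) ℚ) •
        (A k).map (fun q : ℚ => (C q : MvPolynomial (Fin (t + 1)) ℚ))).det ≠ 0 := by
      rw [hdet]
      exact mul_ne_zero (pow_ne_zero _ (X_ne_zero _)) hP
    refine hPencil (t + 1) m ℓ A hprime hinj hne ?_
    have hmap := AlgHom.map_det (aeval (fun i => Real.log (ℓ i)) :
        MvPolynomial (Fin (t + 1)) ℚ →ₐ[ℚ] ℝ)
      (∑ k, (X k : MvPolynomial (Fin (t + 1)) ℚ) •
        (A k).map (fun q : ℚ => (C q : MvPolynomial (Fin (t + 1)) ℚ)))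
    rw [AlgHom.mapMatrix_apply, pencil_map_aeval, hdet, map_mul, map_pow, aeval_X, hzero,
      mul_zero] at hmap
    exact hmap.symm


/-- CERTIFICATE that the open stub is a TRANSFER, not a weakening: the piece implies it (the pencil
determinant is a form of degree `m`, tree `isHomogeneous_det_sum_X_smul`). Together with
`HomPrimeLogSector_of` this makes `stub_primeLogPencilNonsingular ⟺ HomPrimeLogSector`. -/
theorem pencilNonsingular_of_hom (hHom : HomPrimeLogSector) :
    ∀ (t m : ℕ) (ℓ : Fin t → ℕ) (A : Fin t → Matrix (Fin m) (Fin m) ℚ),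
      (∀ k, (ℓ k).Prime) → Function.Injective ℓ →
      (∑ k, (X k : MvPolynomial (Fin t) ℚ) •
          (A k).map (fun q : ℚ => (C q : MvPolynomial (Fin t) ℚ))).det ≠ 0 →
      (∑ k, Real.log (ℓ k) • (A k).map (algebraMap ℚ ℝ)).det ≠ 0 := by
  intro t m ℓ A hprime hinj hdet
  have hhom :=
    Literature.AlgebraicGeometry.DeterminantalHypersurfaces.isHomogeneous_det_sum_X_smul (R := ℚ) A
  have h := hHom t ℓ hprime hinj (Fintype.card (Fin m)) _ hhom hdet
  rwa [AlgHom.map_det, AlgHom.mapMatrix_apply, pencil_map_aeval] at h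

end Summit.Schanuel.Schanuel.Cruxes.HomPrimeLogSector.Birth

end
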